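import Mathlib.LinearAlgebra.Matrix.PosDef
import Mathlib.LinearAlgebra.Matrix.NonsingularInverse
import Mathlib.Algebra.BigOperators.Intervals
import HarnessLib

/-!
# The finite-horizon discrete-time linear–quadratic regulator: Riccati recursion and optimal cost

The deterministic core of the state-feedback LQ / LQG proposition, by completing the square along the
backward Riccati recursion.

Source of the statement with cross term:
N. B. Dehaghani, R. Wisniewski, A. P. Aguiar, *Quantum Solution Framework for Finite-Horizon LQG
Control via Block Encodings and QSVT*, IEEE QCE 2025 = arXiv:2507.09841, §II.A **Proposition 1**
[DehaghaniWisniewskiAguiar2025] (held text p0004), for `x_{k+1} = A x_k + B u_k (+ w_k)`,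
`c(x,u) = xᵀMx + uᵀNu + 2xᵀSu`, terminal cost `x_TᵀM_Tx_T`, `[[M,S],[Sᵀ,N]] ⪰ 0`, `M_T ⪰ 0`, `N ≻ 0`:
> the optimal control policy … is given by `u_k* = K_k x_k`, … where `K_k` is the state feedback gain
> obtained from the standard discrete-time Riccati recursion,
> `K_k := −(N + BᵀP_{k+1}B)⁻¹ (Sᵀ + BᵀP_{k+1}A)`. Furthermore, the corresponding value function has
> the form `F̄_k(x) = xᵀP_kx + r_k`, where `P_k` is the solution to the backward Riccati recursion
> `P_k = M + AᵀP_{k+1}A − (Sᵀ + BᵀP_{k+1}A)ᵀ (N + BᵀP_{k+1}B)⁻¹ (Sᵀ + BᵀP_{k+1}A)` with terminal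
> condition `P_T = M_T` … `r_k = Σ_{j=k+1}^T Tr(ΣP_j)`.

Here the noise-free case (`Σ = 0`, so `r_k = 0`) — the classical dynamic-programming theorem, printed
without cross term in T. Alpcan, T. Başar, *Network Security* (CUP 2010) App. A.3.1 "Affine-quadratic
problems" [AlpcanBasar2010] (held text p0279: `u_k* = −[R + BᵀS_{k+1}B]⁻¹BᵀS_{k+1}A x_k`,
`S_k = Q + AᵀS_{k+1}[I − B P_k S_{k+1}]A`, "the discrete-time Riccati equation … the minimum value of
`J(u)` is `½ x₁ᵀS₁x₁`"), and as the recursive Riccati equation (7.4.81) / stationary gain (7.4.83) of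
F. L. Lewis, *Applied Optimal Control and Estimation* (1992) [Lewis1992] (held text p0301).

Contents (steps-to-go indexing: `riccati j` is `P_{T−j}`, so `riccati 0 = M_T` and the gain used at
stage `k` of a horizon-`T` problem is formed from `riccati (T − (k+1)) = P_{k+1}`):
* `stageCost`, `gainDen P = N + BᵀPB`, `gainNum P = Sᵀ + BᵀPA`, `gain P = −(N + BᵀPB)⁻¹(Sᵀ + BᵀPA)`,
  `riccatiStep`, `riccati`, `traj` (open-loop trajectory), `cost` (the finite-horizon performance index);
* `completing_square` — the one-step identity
  `c(x,u) + (Ax+Bu)ᵀP(Ax+Bu) = xᵀ P⁺ x + (u − Kx)ᵀ(N + BᵀPB)(u − Kx)` (P, N symmetric, `N + BᵀPB`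
  invertible) — "the function of the Riccati equation is to allow us to write the integrand as a
  perfect square" (Lewis p0126);
* `cost_eq_riccati_add_sum` — **exact decomposition** of the cost of ANY input sequence:
  `J_T(x₀, u) = x₀ᵀ P_0 x₀ + Σ_{k<T} (u_k − K_k x_k)ᵀ (N + BᵀP_{k+1}B) (u_k − K_k x_k)`;
* `riccati_posSemidef` / `gainDen_posDef` — under `N ≻ 0`, `M_T ⪰ 0`, `c ≥ 0` every `P_k ⪰ 0` and every
  `N + BᵀP_{k+1}B ≻ 0` (so the recursion never inverts a singular matrix);
* `riccati_le_cost` — **optimality**: `x₀ᵀP_0x₀ ≤ J_T(x₀, u)` for every input sequence;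
  `cost_inputFB_eq_riccati` — the feedback law `u_k = K_k x_k` attains it; `isLeast_cost` packages both
  (Proposition 1 with `Σ = 0`: `min_u J_T = F̄_0(x₀) = x₀ᵀP_0x₀`, `u_k* = K_k x_k`).

Everything is proved; no named facts.  Not formalised: the stochastic term `r_k = Σ Tr(ΣP_j)`, the
output-feedback / Kalman-filter half (§II.B, Prop. 2), infinite-horizon limits (Lewis's theorem on
(7.4.80)–(7.4.81)).

## References
* [DehaghaniWisniewskiAguiar2025] arXiv:2507.09841 = IEEE QCE 2025, §II.A Prop. 1 (eqs. for `K_k`,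
  `P_k`, `P_T = M_T`).
* [AlpcanBasar2010] T. Alpcan, T. Başar, *Network Security: A Decision and Game-Theoretic Approach*,
  CUP 2010, Appendix A.3.1 (dynamic programming for discrete-time systems; affine-quadratic problems;
  the discrete-time Riccati equation; `J(u*)`).
* [Lewis1992] F. L. Lewis, *Applied Optimal Control and Estimation*, Prentice Hall 1992, §7.4
  eqs. (7.4.81), (7.4.83); §3.2 p0126 (the Riccati equation writes the cost as a perfect square).
-/

noncomputable section

open scoped Matrix
open Finset Matrix

namespace Literature.Dynamics.Control

namespace LQR

/-! ### Bilinear bookkeeping (plumbing) -/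

section Plumbing

variable {l m k q : Type*} [Fintype m] [Fintype k] [Fintype q]

/-- `aᵀ X b = bᵀ Xᵀ a`. [folklore] -/
private theorem dot_mulVec_comm (X : Matrix m q ℝ) (a : m → ℝ) (b : q → ℝ) :
    a ⬝ᵥ X *ᵥ b = b ⬝ᵥ Xᵀ *ᵥ a := by
  rw [mulVec_transpose, dotProduct_mulVec, dotProduct_comm]

/-- `(A x)ᵀ P (C y) = xᵀ (Aᵀ (P C)) y`. [folklore] -/
private theorem mulVec_dot_mulVec_mulVec [Fintype l] (A' : Matrix m q ℝ) (P : Matrix m k ℝ)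
    (C : Matrix k l ℝ) (x : q → ℝ) (y : l → ℝ) :
    (A' *ᵥ x) ⬝ᵥ P *ᵥ (C *ᵥ y) = x ⬝ᵥ (A'ᵀ * (P * C)) *ᵥ y := by
  rw [mulVec_mulVec, dotProduct_mulVec, ← vecMul_transpose, vecMul_vecMul, ← dotProduct_mulVec]

end Plumbing

variable {n p : Type*} [Fintype n] [Fintype p] [DecidableEq p]

/-! ### Data: stage cost, Riccati step, gain -/

/-- The stage cost `c(x,u) = xᵀMx + uᵀNu + 2xᵀSu`. [cite: DehaghaniWisniewskiAguiar2025, §II.A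
(display before Prop. 1)] -/
def stageCost (M : Matrix n n ℝ) (S : Matrix n p ℝ) (N : Matrix p p ℝ) (x : n → ℝ) (u : p → ℝ) : ℝ :=
  x ⬝ᵥ M *ᵥ x + u ⬝ᵥ N *ᵥ u + 2 * (x ⬝ᵥ S *ᵥ u)

/-- `N + BᵀPB` (the matrix inverted in the gain). [cite: DehaghaniWisniewskiAguiar2025, §II.A
Prop. 1 (eq. for `K_k`)] -/
def gainDen (B : Matrix n p ℝ) (N : Matrix p p ℝ) (P : Matrix n n ℝ) : Matrix p p ℝ := N + Bᵀ * P * B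

/-- `Sᵀ + BᵀPA`. [cite: DehaghaniWisniewskiAguiar2025, §II.A Prop. 1 (eq. for `K_k`)] -/
def gainNum (A : Matrix n n ℝ) (B : Matrix n p ℝ) (S : Matrix n p ℝ) (P : Matrix n n ℝ) :
    Matrix p n ℝ := Sᵀ + Bᵀ * P * A

/-- **The state-feedback gain** `K = −(N + BᵀPB)⁻¹(Sᵀ + BᵀPA)` (with `P = P_{k+1}` this is `K_k`;
Alpcan–Başar and Lewis write `u = −Kx` with the opposite sign convention and `S = 0`).
[cite: DehaghaniWisniewskiAguiar2025, §II.A Prop. 1; Lewis1992, eq. (7.4.83)] -/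
def gain (A : Matrix n n ℝ) (B : Matrix n p ℝ) (S : Matrix n p ℝ) (N : Matrix p p ℝ)
    (P : Matrix n n ℝ) : Matrix p n ℝ :=
  -((gainDen B N P)⁻¹ * gainNum A B S P)

/-- **One backward Riccati step** `P ↦ M + AᵀPA − (Sᵀ + BᵀPA)ᵀ(N + BᵀPB)⁻¹(Sᵀ + BᵀPA)`.
[cite: DehaghaniWisniewskiAguiar2025, §II.A Prop. 1 (eq. for `P_k`); Lewis1992, eq. (7.4.81);
AlpcanBasar2010, App. A.3.1 (discrete-time Riccati equation)] -/
def riccatiStep (A : Matrix n n ℝ) (B : Matrix n p ℝ) (M : Matrix n n ℝ) (S : Matrix n p ℝ)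
    (N : Matrix p p ℝ) (P : Matrix n n ℝ) : Matrix n n ℝ :=
  M + Aᵀ * P * A - (gainNum A B S P)ᵀ * ((gainDen B N P)⁻¹ * gainNum A B S P)

/-- **The Riccati recursion in steps-to-go**: `riccati 0 = M_T` and `riccati (j+1) = step (riccati j)`,
so that `P_k = riccati (T − k)`. [cite: DehaghaniWisniewskiAguiar2025, §II.A Prop. 1 (`P_T = M_T`)] -/
def riccati (A : Matrix n n ℝ) (B : Matrix n p ℝ) (M : Matrix n n ℝ) (S : Matrix n p ℝ)
    (N : Matrix p p ℝ) (MT : Matrix n n ℝ) : ℕ → Matrix n n ℝ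
  | 0 => MT
  | j + 1 => riccatiStep A B M S N (riccati A B M S N MT j)

/-- The open-loop state trajectory `x_{k+1} = A x_k + B u_k` from `x₀` under the input sequence `u`.
[cite: DehaghaniWisniewskiAguiar2025, §II.A eq. (9) (noise-free)] -/
def traj (A : Matrix n n ℝ) (B : Matrix n p ℝ) (x₀ : n → ℝ) (u : ℕ → p → ℝ) : ℕ → n → ℝ
  | 0 => x₀
  | k + 1 => A *ᵥ traj A B x₀ u k + B *ᵥ u k

/-- **The finite-horizon cost** `J_T(x₀,u) = Σ_{k<T} c(x_k, u_k) + x_Tᵀ M_T x_T`.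
[cite: DehaghaniWisniewskiAguiar2025, §II.A eq. (10) (noise-free); AlpcanBasar2010, App. A.3.1] -/
def cost (A : Matrix n n ℝ) (B : Matrix n p ℝ) (M : Matrix n n ℝ) (S : Matrix n p ℝ)
    (N : Matrix p p ℝ) (MT : Matrix n n ℝ) (T : ℕ) (x₀ : n → ℝ) (u : ℕ → p → ℝ) : ℝ :=
  ∑ k ∈ range T, stageCost M S N (traj A B x₀ u k) (u k) + traj A B x₀ u T ⬝ᵥ MT *ᵥ traj A B x₀ u T

variable {A : Matrix n n ℝ} {B : Matrix n p ℝ} {M : Matrix n n ℝ} {S : Matrix n p ℝ}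
  {N : Matrix p p ℝ} {MT : Matrix n n ℝ}

omit [DecidableEq p] in
/-- `x_0 = x₀`. [folklore] -/
private theorem traj_zero (x₀ : n → ℝ) (u : ℕ → p → ℝ) : traj A B x₀ u 0 = x₀ := rfl

/-- `riccati (j+1)` is one Riccati step applied to `riccati j` (`P_k` from `P_{k+1}`).
[cite: DehaghaniWisniewskiAguiar2025, §II.A Prop. 1 (backward Riccati recursion)] -/
theorem riccati_succ (j : ℕ) :
    riccati A B M S N MT (j + 1) = riccatiStep A B M S N (riccati A B M S N MT j) := rfl

/-! ### Completing the square -/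

omit [Fintype p] [DecidableEq p] in
/-- `N + BᵀPB` is symmetric when `N` and `P` are. [folklore] -/
private theorem gainDen_transpose (hN : Nᵀ = N) {P : Matrix n n ℝ} (hP : Pᵀ = P) :
    (gainDen B N P)ᵀ = gainDen B N P := by
  unfold gainDen
  rw [transpose_add, hN, transpose_mul, transpose_mul, transpose_transpose, hP, ← Matrix.mul_assoc]

/-- **Completing the square** ("the function of the Riccati equation is to allow us to write the
integrand as a perfect square"): for symmetric `P`, symmetric `N` and invertible `N + BᵀPB`,
`c(x,u) + (Ax+Bu)ᵀ P (Ax+Bu) = xᵀ P⁺ x + (u − Kx)ᵀ (N + BᵀPB) (u − Kx)` with `P⁺` the Riccati step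
and `K` the gain. [cite: Lewis1992, §3.2 p0126 (perfect square) and eq. (7.4.81);
DehaghaniWisniewskiAguiar2025, §II.A Prop. 1] -/
theorem completing_square (hN : Nᵀ = N) {P : Matrix n n ℝ} (hP : Pᵀ = P)
    (hG : IsUnit (gainDen B N P).det) (x : n → ℝ) (u : p → ℝ) :
    stageCost M S N x u + (A *ᵥ x + B *ᵥ u) ⬝ᵥ P *ᵥ (A *ᵥ x + B *ᵥ u) =
      x ⬝ᵥ riccatiStep A B M S N P *ᵥ x +
        (u - gain A B S N P *ᵥ x) ⬝ᵥ gainDen B N P *ᵥ (u - gain A B S N P *ᵥ x) := by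
  -- abbreviations
  set G := gainDen B N P with hGdef
  set H := gainNum A B S P with hHdef
  set K := gain A B S N P with hKdef
  have hGt : Gᵀ = G := gainDen_transpose hN hP
  have hGK : G * K = -H := by
    rw [hKdef, gain, ← hGdef, ← hHdef, Matrix.mul_neg, ← Matrix.mul_assoc, mul_nonsing_inv G hG,
      Matrix.one_mul]
  have hKGK : Kᵀ * (G * K) = Hᵀ * (G⁻¹ * H) := by
    rw [hGK, hKdef, gain, ← hGdef, ← hHdef, transpose_neg, Matrix.neg_mul, Matrix.mul_neg, neg_neg,
      transpose_mul, transpose_nonsing_inv, hGt, Matrix.mul_assoc]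
  -- LHS, expanded into six atoms
  have hL : stageCost M S N x u + (A *ᵥ x + B *ᵥ u) ⬝ᵥ P *ᵥ (A *ᵥ x + B *ᵥ u) =
      x ⬝ᵥ M *ᵥ x + u ⬝ᵥ N *ᵥ u + 2 * (u ⬝ᵥ Sᵀ *ᵥ x) + x ⬝ᵥ (Aᵀ * (P * A)) *ᵥ x
        + 2 * (u ⬝ᵥ (Bᵀ * (P * A)) *ᵥ x) + u ⬝ᵥ (Bᵀ * (P * B)) *ᵥ u := by
    unfold stageCost
    rw [mulVec_add, add_dotProduct, dotProduct_add, dotProduct_add,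
      mulVec_dot_mulVec_mulVec A P A, mulVec_dot_mulVec_mulVec A P B,
      mulVec_dot_mulVec_mulVec B P A, mulVec_dot_mulVec_mulVec B P B,
      dot_mulVec_comm S x u, dot_mulVec_comm (Aᵀ * (P * B)) x u]
    have ht : (Aᵀ * (P * B))ᵀ = Bᵀ * (P * A) := by
      rw [transpose_mul, transpose_mul, transpose_transpose, hP, Matrix.mul_assoc]
    rw [ht]
    ring
  -- RHS, expanded into the atoms `uᵀGu`, `uᵀHx`, `xᵀHᵀG⁻¹Hx`
  have e1 : u ⬝ᵥ G *ᵥ (K *ᵥ x) = -(u ⬝ᵥ H *ᵥ x) := by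
    rw [mulVec_mulVec, hGK, neg_mulVec, dotProduct_neg]
  have e2 : (K *ᵥ x) ⬝ᵥ G *ᵥ u = -(u ⬝ᵥ H *ᵥ x) := by
    rw [dot_mulVec_comm G (K *ᵥ x) u, hGt, e1]
  have e3 : (K *ᵥ x) ⬝ᵥ G *ᵥ (K *ᵥ x) = x ⬝ᵥ (Hᵀ * (G⁻¹ * H)) *ᵥ x := by
    rw [mulVec_dot_mulVec_mulVec K G K, hKGK]
  have hR : x ⬝ᵥ riccatiStep A B M S N P *ᵥ x + (u - K *ᵥ x) ⬝ᵥ G *ᵥ (u - K *ᵥ x) =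
      x ⬝ᵥ M *ᵥ x + x ⬝ᵥ (Aᵀ * (P * A)) *ᵥ x - x ⬝ᵥ (Hᵀ * (G⁻¹ * H)) *ᵥ x
        + (u ⬝ᵥ G *ᵥ u + 2 * (u ⬝ᵥ H *ᵥ x) + x ⬝ᵥ (Hᵀ * (G⁻¹ * H)) *ᵥ x) := by
    have h1 : x ⬝ᵥ riccatiStep A B M S N P *ᵥ x =
        x ⬝ᵥ M *ᵥ x + x ⬝ᵥ (Aᵀ * (P * A)) *ᵥ x - x ⬝ᵥ (Hᵀ * (G⁻¹ * H)) *ᵥ x := by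
      unfold riccatiStep
      rw [← hGdef, ← hHdef, sub_mulVec, add_mulVec, dotProduct_sub, dotProduct_add, Matrix.mul_assoc]
    have h2 : (u - K *ᵥ x) ⬝ᵥ G *ᵥ (u - K *ᵥ x) =
        u ⬝ᵥ G *ᵥ u + 2 * (u ⬝ᵥ H *ᵥ x) + x ⬝ᵥ (Hᵀ * (G⁻¹ * H)) *ᵥ x := by
      rw [mulVec_sub, sub_dotProduct, dotProduct_sub, dotProduct_sub, e1, e2, e3]
      ring
    rw [h1, h2]
  rw [hL, hR]
  -- expand `G = N + BᵀPB` and `H = Sᵀ + BᵀPA` in the atoms and compare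
  have hGu : u ⬝ᵥ G *ᵥ u = u ⬝ᵥ N *ᵥ u + u ⬝ᵥ (Bᵀ * (P * B)) *ᵥ u := by
    rw [hGdef, gainDen, add_mulVec, dotProduct_add, Matrix.mul_assoc]
  have hHx : u ⬝ᵥ H *ᵥ x = u ⬝ᵥ Sᵀ *ᵥ x + u ⬝ᵥ (Bᵀ * (P * A)) *ᵥ x := by
    rw [hHdef, gainNum, add_mulVec, dotProduct_add, Matrix.mul_assoc]
  rw [hGu, hHx]
  ring

/-! ### The exact cost decomposition along the recursion -/

/-- Symmetry is preserved by the Riccati step. [folklore] -/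
private theorem riccatiStep_transpose (hM : Mᵀ = M) (hN : Nᵀ = N) {P : Matrix n n ℝ} (hP : Pᵀ = P) :
    (riccatiStep A B M S N P)ᵀ = riccatiStep A B M S N P := by
  have hGt : ((gainDen B N P)⁻¹)ᵀ = (gainDen B N P)⁻¹ := by
    rw [transpose_nonsing_inv, gainDen_transpose hN hP]
  have h1 : (Aᵀ * P * A)ᵀ = Aᵀ * P * A := by
    rw [transpose_mul, transpose_mul, transpose_transpose, hP, Matrix.mul_assoc]
  have h2 : ((gainNum A B S P)ᵀ * ((gainDen B N P)⁻¹ * gainNum A B S P))ᵀ =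
      (gainNum A B S P)ᵀ * ((gainDen B N P)⁻¹ * gainNum A B S P) := by
    rw [transpose_mul, transpose_mul, transpose_transpose, hGt, Matrix.mul_assoc]
  unfold riccatiStep
  rw [transpose_sub, transpose_add, hM, h1, h2]

/-- Every `P_k` is symmetric (for symmetric `M`, `N`, `M_T`). [folklore] -/
private theorem riccati_transpose (hM : Mᵀ = M) (hN : Nᵀ = N) (hMT : MTᵀ = MT) (j : ℕ) :
    (riccati A B M S N MT j)ᵀ = riccati A B M S N MT j := by
  induction j with
  | zero => exact hMT
  | succ j ih => exact riccatiStep_transpose hM hN ih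

omit [DecidableEq p] in
/-- Shifting the trajectory by one step. [folklore] -/
private theorem traj_succ_eq (x₀ : n → ℝ) (u : ℕ → p → ℝ) (k : ℕ) :
    traj A B x₀ u (k + 1) = traj A B (A *ᵥ x₀ + B *ᵥ u 0) (fun i => u (i + 1)) k := by
  induction k with
  | zero => rfl
  | succ k ih =>
      show A *ᵥ traj A B x₀ u (k + 1) + B *ᵥ u (k + 1) = _
      rw [ih]
      rfl

omit [DecidableEq p] in
/-- Peeling the first stage off the cost: `J_{T+1}(x₀,u) = c(x₀,u₀) + J_T(x₁, u_{·+1})`.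
[cite: AlpcanBasar2010, App. A.3.1 (the DP equation)] -/
theorem cost_succ (T : ℕ) (x₀ : n → ℝ) (u : ℕ → p → ℝ) :
    cost A B M S N MT (T + 1) x₀ u =
      stageCost M S N x₀ (u 0) + cost A B M S N MT T (A *ᵥ x₀ + B *ᵥ u 0) (fun i => u (i + 1)) := by
  unfold cost
  rw [sum_range_succ', traj_succ_eq]
  simp only [traj_succ_eq x₀ u]
  simp only [traj]
  ring

/-- **Exact decomposition of the cost of an arbitrary input sequence**: with `P_k = riccati (T−k)`,
`K_k` the gain and `G_k = N + BᵀP_{k+1}B`, both formed from `P_{k+1} = riccati (T − (k+1))`,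
`J_T(x₀,u) = x₀ᵀ P_0 x₀ + Σ_{k<T} (u_k − K_k x_k)ᵀ G_k (u_k − K_k x_k)` — the value function plus a sum
of squares that vanishes exactly for the feedback law. [cite: DehaghaniWisniewskiAguiar2025, §II.A
Prop. 1 (`F̄_k(x) = xᵀP_kx`); AlpcanBasar2010, App. A.3.1; Lewis1992, §7.4 eq. (7.4.81)] -/
theorem cost_eq_riccati_add_sum (hM : Mᵀ = M) (hN : Nᵀ = N) (hMT : MTᵀ = MT) (T : ℕ)
    (hG : ∀ j < T, IsUnit (gainDen B N (riccati A B M S N MT j)).det) (x₀ : n → ℝ)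
    (u : ℕ → p → ℝ) :
    cost A B M S N MT T x₀ u =
      x₀ ⬝ᵥ riccati A B M S N MT T *ᵥ x₀ +
        ∑ k ∈ range T,
          (u k - gain A B S N (riccati A B M S N MT (T - (k + 1))) *ᵥ traj A B x₀ u k) ⬝ᵥ
            gainDen B N (riccati A B M S N MT (T - (k + 1))) *ᵥ
              (u k - gain A B S N (riccati A B M S N MT (T - (k + 1))) *ᵥ traj A B x₀ u k) := by
  induction T generalizing x₀ u with
  | zero => simp [cost, traj, riccati]
  | succ T ih =>
      rw [cost_succ, ih (fun j hj => hG j (Nat.lt_succ_of_lt hj)), sum_range_succ']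
      -- the peeled stage plus the value at `x₁` is the value at `x₀` plus the first square
      have hsq := completing_square (A := A) (M := M) (S := S) hN (riccati_transpose hM hN hMT T)
        (hG T (Nat.lt_succ_self T)) x₀ (u 0)
      simp only [Nat.add_sub_add_right, zero_add, Nat.add_sub_cancel, traj_succ_eq x₀ u, traj_zero]
      rw [riccati_succ]
      linarith [hsq]

/-! ### Positivity: the recursion is well defined and gives a lower bound -/

omit [DecidableEq p] in
/-- If `N ≻ 0` and `P ⪰ 0` then `N + BᵀPB ≻ 0` (in particular invertible).
[cite: DehaghaniWisniewskiAguiar2025, §II.A Prop. 1 (hypothesis `N > 0`)] -/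
theorem gainDen_posDef_of (hN : N.PosDef) {P : Matrix n n ℝ} (hP : P.PosSemidef) :
    (gainDen B N P).PosDef := by
  unfold gainDen
  have h : (Bᵀ * P * B).PosSemidef := by
    have := hP.conjTranspose_mul_mul_same B
    rwa [conjTranspose_eq_transpose_of_trivial] at this
  exact hN.add_posSemidef h

/-- A real Hermitian matrix is symmetric. [folklore] -/
private theorem transpose_eq_of_isHermitian {ι : Type*} {X : Matrix ι ι ℝ} (h : X.IsHermitian) :
    Xᵀ = X := by
  have := h.eq
  rwa [conjTranspose_eq_transpose_of_trivial] at this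

/-- **`P_k ⪰ 0` along the recursion** when `N ≻ 0`, `M_T ⪰ 0`, `M` is symmetric and the stage cost
is nonnegative (`[[M,S],[Sᵀ,N]] ⪰ 0`): `xᵀP⁺x` is the one-step cost-to-go of the feedback input,
`c(x, Kx) + (Ax + BKx)ᵀP(Ax + BKx) ≥ 0`. [cite: DehaghaniWisniewskiAguiar2025, §II.A Prop. 1
(hypotheses); AlpcanBasar2010, App. A.3.1 (`R > 0`, `Q ≥ 0`)] -/
theorem riccati_posSemidef (hN : N.PosDef) (hMT : MT.PosSemidef) (hM : Mᵀ = M)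
    (hc : ∀ x u, 0 ≤ stageCost M S N x u) (j : ℕ) :
    (riccati A B M S N MT j).PosSemidef := by
  have hNt : Nᵀ = N := transpose_eq_of_isHermitian hN.1
  have hMTt : MTᵀ = MT := transpose_eq_of_isHermitian hMT.1
  induction j with
  | zero => exact hMT
  | succ j ih =>
      have hPt : (riccati A B M S N MT j)ᵀ = riccati A B M S N MT j := riccati_transpose hM hNt hMTt j
      have hG : (gainDen B N (riccati A B M S N MT j)).PosDef := gainDen_posDef_of hN ih
      have hGu : IsUnit (gainDen B N (riccati A B M S N MT j)).det :=
        (isUnit_iff_isUnit_det _).mp hG.isUnit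
      have hH : (riccati A B M S N MT (j + 1)).IsHermitian := by
        unfold Matrix.IsHermitian
        rw [conjTranspose_eq_transpose_of_trivial, riccati_succ]
        exact riccatiStep_transpose hM hNt hPt
      refine PosSemidef.of_dotProduct_mulVec_nonneg hH fun x => ?_
      rw [star_trivial, riccati_succ]
      -- evaluate the completed square at the feedback input `u = Kx`
      have hsq := completing_square (A := A) (M := M) (S := S) hNt hPt hGu x
        (gain A B S N (riccati A B M S N MT j) *ᵥ x)
      rw [sub_self, zero_dotProduct, add_zero] at hsq
      have h2 := ih.dotProduct_mulVec_nonneg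
        (A *ᵥ x + B *ᵥ (gain A B S N (riccati A B M S N MT j) *ᵥ x))
      rw [star_trivial] at h2
      linarith [hc x (gain A B S N (riccati A B M S N MT j) *ᵥ x)]

/-- Hence every `N + BᵀP_kB ≻ 0` and the recursion never meets a singular matrix.
[cite: DehaghaniWisniewskiAguiar2025, §II.A Prop. 1] -/
theorem gainDen_posDef (hN : N.PosDef) (hMT : MT.PosSemidef) (hM : Mᵀ = M)
    (hc : ∀ x u, 0 ≤ stageCost M S N x u) (j : ℕ) :
    (gainDen B N (riccati A B M S N MT j)).PosDef :=
  gainDen_posDef_of hN (riccati_posSemidef hN hMT hM hc j)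

/-- **Optimality (lower bound)**: for every input sequence, `J_T(x₀,u) ≥ x₀ᵀ P_0 x₀`.
[cite: DehaghaniWisniewskiAguiar2025, §II.A Prop. 1 (`F̄_0` is the optimal cost);
AlpcanBasar2010, App. A.3.1 ("the minimum value of `J(u)` is `½x₁ᵀS₁x₁`")] -/
theorem riccati_le_cost (hN : N.PosDef) (hMT : MT.PosSemidef) (hM : Mᵀ = M)
    (hc : ∀ x u, 0 ≤ stageCost M S N x u) (T : ℕ) (x₀ : n → ℝ) (u : ℕ → p → ℝ) :
    x₀ ⬝ᵥ riccati A B M S N MT T *ᵥ x₀ ≤ cost A B M S N MT T x₀ u := by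
  have hNt : Nᵀ = N := transpose_eq_of_isHermitian hN.1
  have hMTt : MTᵀ = MT := transpose_eq_of_isHermitian hMT.1
  have hGu : ∀ j < T, IsUnit (gainDen B N (riccati A B M S N MT j)).det :=
    fun j _ => (isUnit_iff_isUnit_det _).mp (gainDen_posDef hN hMT hM hc j).isUnit
  rw [cost_eq_riccati_add_sum hM hNt hMTt T hGu x₀ u]
  have hsum : 0 ≤ ∑ k ∈ range T,
      (u k - gain A B S N (riccati A B M S N MT (T - (k + 1))) *ᵥ traj A B x₀ u k) ⬝ᵥ
        gainDen B N (riccati A B M S N MT (T - (k + 1))) *ᵥ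
          (u k - gain A B S N (riccati A B M S N MT (T - (k + 1))) *ᵥ traj A B x₀ u k) := by
    refine sum_nonneg fun k _ => ?_
    have := (gainDen_posDef (A := A) (B := B) hN hMT hM hc (T - (k + 1))).posSemidef
      |>.dotProduct_mulVec_nonneg
      (u k - gain A B S N (riccati A B M S N MT (T - (k + 1))) *ᵥ traj A B x₀ u k)
    rwa [star_trivial] at this
  linarith

/-! ### The feedback law attains the value -/

/-- The closed-loop trajectory under `u_k = K_k x_k`, `K_k` formed from `P_{k+1} = riccati (T−(k+1))`.
[cite: DehaghaniWisniewskiAguiar2025, §II.A Prop. 1 (`u_k* = K_k x_k`)] -/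
def trajFB (A : Matrix n n ℝ) (B : Matrix n p ℝ) (M : Matrix n n ℝ) (S : Matrix n p ℝ)
    (N : Matrix p p ℝ) (MT : Matrix n n ℝ) (T : ℕ) (x₀ : n → ℝ) : ℕ → n → ℝ
  | 0 => x₀
  | k + 1 => A *ᵥ trajFB A B M S N MT T x₀ k +
      B *ᵥ (gain A B S N (riccati A B M S N MT (T - (k + 1))) *ᵥ trajFB A B M S N MT T x₀ k)

/-- The feedback input sequence `u_k = K_k x_k` read off the closed-loop trajectory.
[cite: DehaghaniWisniewskiAguiar2025, §II.A Prop. 1] -/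
def inputFB (A : Matrix n n ℝ) (B : Matrix n p ℝ) (M : Matrix n n ℝ) (S : Matrix n p ℝ)
    (N : Matrix p p ℝ) (MT : Matrix n n ℝ) (T : ℕ) (x₀ : n → ℝ) : ℕ → p → ℝ :=
  fun k => gain A B S N (riccati A B M S N MT (T - (k + 1))) *ᵥ trajFB A B M S N MT T x₀ k

/-- The open-loop trajectory (9) driven by the feedback inputs `u_k = K_k x_k` is the closed-loop
trajectory. [cite: DehaghaniWisniewskiAguiar2025, §II.A eq. (9) and Prop. 1 (`u_k* = K_k x_k`)] -/
theorem traj_inputFB (T : ℕ) (x₀ : n → ℝ) (k : ℕ) :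
    traj A B x₀ (inputFB A B M S N MT T x₀) k = trajFB A B M S N MT T x₀ k := by
  induction k with
  | zero => rfl
  | succ k ih =>
      show A *ᵥ traj A B x₀ (inputFB A B M S N MT T x₀) k + B *ᵥ inputFB A B M S N MT T x₀ k = _
      rw [ih]
      rfl

/-- **The feedback law is optimal**: `J_T(x₀, u*) = x₀ᵀ P_0 x₀` for `u_k* = K_k x_k`.
[cite: DehaghaniWisniewskiAguiar2025, §II.A Prop. 1; AlpcanBasar2010, App. A.3.1 (`J(u*)`)] -/
theorem cost_inputFB_eq_riccati (hN : N.PosDef) (hMT : MT.PosSemidef) (hM : Mᵀ = M)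
    (hc : ∀ x u, 0 ≤ stageCost M S N x u) (T : ℕ) (x₀ : n → ℝ) :
    cost A B M S N MT T x₀ (inputFB A B M S N MT T x₀) = x₀ ⬝ᵥ riccati A B M S N MT T *ᵥ x₀ := by
  have hNt : Nᵀ = N := transpose_eq_of_isHermitian hN.1
  have hMTt : MTᵀ = MT := transpose_eq_of_isHermitian hMT.1
  have hGu : ∀ j < T, IsUnit (gainDen B N (riccati A B M S N MT j)).det :=
    fun j _ => (isUnit_iff_isUnit_det _).mp (gainDen_posDef hN hMT hM hc j).isUnit
  rw [cost_eq_riccati_add_sum hM hNt hMTt T hGu, sum_eq_zero fun k _ => ?_, add_zero]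
  rw [traj_inputFB]
  simp [inputFB]

/-- **Proposition 1, noise-free, packaged**: under `N ≻ 0`, `M_T ⪰ 0`, symmetric `M` and nonnegative
stage cost, `min_u J_T(x₀,u) = x₀ᵀP_0x₀`, attained by `u_k = K_k x_k`.
[cite: DehaghaniWisniewskiAguiar2025, §II.A Prop. 1; AlpcanBasar2010, App. A.3.1] -/
theorem isLeast_cost (hN : N.PosDef) (hMT : MT.PosSemidef) (hM : Mᵀ = M)
    (hc : ∀ x u, 0 ≤ stageCost M S N x u) (T : ℕ) (x₀ : n → ℝ) :
    IsLeast (Set.range fun u : ℕ → p → ℝ => cost A B M S N MT T x₀ u)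
      (x₀ ⬝ᵥ riccati A B M S N MT T *ᵥ x₀) :=
  ⟨⟨inputFB A B M S N MT T x₀, cost_inputFB_eq_riccati hN hMT hM hc T x₀⟩,
    by rintro _ ⟨u, rfl⟩; exact riccati_le_cost hN hMT hM hc T x₀ u⟩

end LQR

end Literature.Dynamics.Control

end
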